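import Summits.CriticalPhenomena.PercolationContinuityZ3.Theorems.PercNearOneGluingNoHeavyLowerTailAttachedChampion
import Literature.Probability.Percolation.LonelyClusterExchange
import HarnessLib

/-!
# `NoHeavyLowerTail` (stmt-CriticalPhenomena-4575) — quantitative gluing response: the two-observer transfer
# with a deficiency term (QGR)

Lead of the crux, 2026-08-18.  `μ = prodBernoulli w`, relays `A`, level `j`, `R_v = {|π(v)| ≤ j}`,
`π(x) ∪ π(y)` = the relays joined to `x` or to `y` (the relay content of the block obtained by gluing `x` and `y`).

The tree's `twoObserver_le_of_lonelier` (BHK 2006 Thm. 1.5 + bookkeeping) says: if `μ(R_y) ≤ μ(R_c)` then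
`μ(c ↮ x, c ↮ y, 1 ≤ |π(x) ∪ π(y)| ≤ j) ≤ μ(c ↮ x, c ↮ y, |π(c)| ≤ j)`.  Here the hypothesis is dropped at the price of
the deficiency `(μ(R_y) − μ(R_c))⁺`:

* `twoObserver_le_add_posPart` (**QGR**): for all vertices `x, y, c`,
  `μ(c ↮ x, c ↮ y, 1 ≤ |π(x) ∪ π(y)| ≤ j) ≤ μ(c ↮ x, c ↮ y, |π(c)| ≤ j) + max 0 (μ(R_y) − μ(R_c))`.
  In the Steiner-region formulation of the attached-champion inequality (memo ATTACHED-CHAMPION.md, Add. 6) this is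
  the gluing-response bound `d^{W} ≥ min(0, max_{y ∈ W} (s_c − s_y))`: the champion's margin over a glued block is at
  least its best margin over a member, capped at `0` (numerically 0 violations / 6 000; the abstract `m = 3` analysis shows
  it is necessary but not sufficient).
  Proof: the same bookkeeping as the tree lemma, run on the product form `lonelyClusterExchange`; in the case
  `μ(R_y) ≥ μ(R_c)` the exchange gives `μ(D ∩ R_c ∩ X) ≤ μ(D ∩ X ∩ R_y)` (`D = {y ↮ c}`, `X = {c ↔ x}`) because
  `μ(D ∩ R_c) ≤ μ(D ∩ R_y)` (the two loneliness events agree on `{y ↔ c}`).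
-/

noncomputable section

namespace Summit.CriticalPhenomena.PercolationContinuityZ3.Theorems

open MeasureTheory Set Literature.Probability.LatticeModels Literature.Probability.Percolation
open scoped Classical BigOperators

namespace AttachedChampionGluingResponse

variable {n : ℕ}

/-- **QGR — the two-observer transfer with deficiency.**  For vertices `x, y, c`, relays `A`, level `j`:
`μ(c ↮ x, c ↮ y, 1 ≤ |π(x) ∪ π(y)| ≤ j) ≤ μ(c ↮ x, c ↮ y, |π(c)| ≤ j) + max 0 (μ(R_y) − μ(R_c))`.
[derived from: VandenbergHaggstromKahn2005, Thm. 1.5, via `lonelyClusterExchange` / `twoObserver_le_of_lonelier`] -/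
theorem twoObserver_le_add_posPart (w : Sym2 (Fin n) → unitInterval) (A : Finset (Fin n)) (x y c : Fin n)
    (j : ℕ) :
    (prodBernoulli w).real {ω : BondConfig (Fin n) | ω ∉ openConn c x ∧ ω ∉ openConn c y ∧
        1 ≤ (A.filter fun z => ω ∈ openConn x z ∨ ω ∈ openConn y z).card ∧
        (A.filter fun z => ω ∈ openConn x z ∨ ω ∈ openConn y z).card ≤ j} ≤
      (prodBernoulli w).real {ω : BondConfig (Fin n) | ω ∉ openConn c x ∧ ω ∉ openConn c y ∧
        (A.filter fun z => ω ∈ openConn c z).card ≤ j} +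
      max 0 ((prodBernoulli w).real {ω : BondConfig (Fin n) | (A.filter fun z => ω ∈ openConn y z).card ≤ j} -
        (prodBernoulli w).real {ω : BondConfig (Fin n) | (A.filter fun z => ω ∈ openConn c z).card ≤ j}) := by
  set μ := prodBernoulli w with hμ
  set Rc : Set (BondConfig (Fin n)) := {ω | (A.filter fun z => ω ∈ openConn c z).card ≤ j} with hRc
  set Ry : Set (BondConfig (Fin n)) := {ω | (A.filter fun z => ω ∈ openConn y z).card ≤ j} with hRy
  by_cases hle : μ.real Ry ≤ μ.real Rc
  · -- the tree lemma, plus `0 ≤ max 0 _`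
    exact (twoObserver_le_of_lonelier w A x y c j hle).trans (le_add_of_nonneg_right (le_max_left _ _))
  have hlt : μ.real Rc < μ.real Ry := lt_of_not_ge hle
  rw [max_eq_right (sub_nonneg.2 hlt.le)]
  set D : Set (BondConfig (Fin n)) := (openConn y c)ᶜ with hD
  set X : Set (BondConfig (Fin n)) := openConn c x with hX
  have hmeas : ∀ S : Set (BondConfig (Fin n)), MeasurableSet S := fun _ => MeasurableSet.of_discrete
  have hyc : y ≠ c := by
    rintro rfl; exact absurd le_rfl hle
  have hsymm : (openConn y c : Set (BondConfig (Fin n))) = openConn c y :=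
    Set.ext fun _ => ⟨SimpleGraph.Reachable.symm, SimpleGraph.Reachable.symm⟩
  have hR : {ω : BondConfig (Fin n) | ω ∉ openConn c x ∧ ω ∉ openConn c y ∧
      (A.filter fun z => ω ∈ openConn c z).card ≤ j} = (Rc ∩ D) \ X := by
    ext ω
    simp only [hRc, hD, hX, mem_sdiff, mem_inter_iff, mem_compl_iff, mem_setOf_eq, hsymm]
    tauto
  have hL : {ω : BondConfig (Fin n) | ω ∉ openConn c x ∧ ω ∉ openConn c y ∧
      1 ≤ (A.filter fun z => ω ∈ openConn x z ∨ ω ∈ openConn y z).card ∧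
      (A.filter fun z => ω ∈ openConn x z ∨ ω ∈ openConn y z).card ≤ j} ⊆ (Ry ∩ D) \ X := by
    intro ω hω
    obtain ⟨hcx, hcy, -, hU⟩ := hω
    simp only [hRy, hD, hX, mem_sdiff, mem_inter_iff, mem_compl_iff, mem_setOf_eq, hsymm]
    refine ⟨⟨le_trans (Finset.card_le_card ?_) hU, hcy⟩, hcx⟩
    intro z hz
    rw [Finset.mem_filter] at hz ⊢
    exact ⟨hz.1, Or.inr hz.2⟩
  rw [hR]
  refine le_trans (measureReal_mono hL (measure_ne_top μ _)) ?_
  -- the exchange (product form) with `s = y`, `t = c`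
  have hE : μ.real (D ∩ (Rc ∩ X)) * μ.real (D ∩ Ry) ≤ μ.real (D ∩ Rc) * μ.real (D ∩ (X ∩ Ry)) :=
    lonelyClusterExchange w hyc x A j
  -- on `{y ↔ c}` the loneliness events coincide
  have hF2 : Rc \ D = Ry \ D := by
    ext ω
    simp only [hRc, hRy, hD, mem_sdiff, mem_compl_iff, not_not, mem_setOf_eq]
    constructor
    · rintro ⟨h, hyc'⟩
      have hyc'' : (openGraph ω).Reachable y c := hyc'
      have heq : (A.filter fun z => ω ∈ openConn y z) = (A.filter fun z => ω ∈ openConn c z) :=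
        Finset.filter_congr fun z _ =>
          ⟨fun hz => (hyc''.symm.trans hz : (openGraph ω).Reachable c z),
            fun hz => (hyc''.trans hz : (openGraph ω).Reachable y z)⟩
      rw [heq]
      exact ⟨h, hyc'⟩
    · rintro ⟨h, hyc'⟩
      have hyc'' : (openGraph ω).Reachable y c := hyc'
      have heq : (A.filter fun z => ω ∈ openConn c z) = (A.filter fun z => ω ∈ openConn y z) :=
        Finset.filter_congr fun z _ =>
          ⟨fun hz => (hyc''.trans hz : (openGraph ω).Reachable y z),
            fun hz => (hyc''.symm.trans hz : (openGraph ω).Reachable c z)⟩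
      rw [heq]
      exact ⟨h, hyc'⟩
  -- splittings
  have hc1 : μ.real (Rc ∩ D) + μ.real (Rc \ D) = μ.real Rc := measureReal_inter_add_sdiff (hmeas D)
  have hy1 : μ.real (Ry ∩ D) + μ.real (Ry \ D) = μ.real Ry := measureReal_inter_add_sdiff (hmeas D)
  have hc2 : μ.real (Rc ∩ D ∩ X) + μ.real ((Rc ∩ D) \ X) = μ.real (Rc ∩ D) :=
    measureReal_inter_add_sdiff (hmeas X)
  have hy2 : μ.real (Ry ∩ D ∩ X) + μ.real ((Ry ∩ D) \ X) = μ.real (Ry ∩ D) :=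
    measureReal_inter_add_sdiff (hmeas X)
  have e1 : Rc ∩ D ∩ X = D ∩ (Rc ∩ X) := by ext ω; simp only [mem_inter_iff]; tauto
  have e4 : Ry ∩ D ∩ X = D ∩ (X ∩ Ry) := by ext ω; simp only [mem_inter_iff]; tauto
  rw [e1] at hc2
  rw [e4] at hy2
  rw [hF2] at hc1
  have e2 : (D ∩ Rc : Set (BondConfig (Fin n))) = Rc ∩ D := inter_comm _ _
  have e3 : (D ∩ Ry : Set (BondConfig (Fin n))) = Ry ∩ D := inter_comm _ _
  rw [e2, e3] at hE
  -- `μ(Rc ∩ D) ≤ μ(Ry ∩ D)` since `μ Rc < μ Ry` and the sdiff parts agree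
  have hDle : μ.real (Rc ∩ D) ≤ μ.real (Ry ∩ D) := by linarith
  -- the key step: `μ(D ∩ Rc ∩ X) ≤ μ(D ∩ X ∩ Ry)`
  have hkey : μ.real (D ∩ (Rc ∩ X)) ≤ μ.real (D ∩ (X ∩ Ry)) := by
    by_cases h0 : μ.real (Ry ∩ D) = 0
    · have h1 : μ.real (D ∩ (Rc ∩ X)) ≤ μ.real (Rc ∩ D) := by
        refine measureReal_mono (fun ω hω => ?_) (measure_ne_top μ _)
        exact ⟨hω.2.1, hω.1⟩
      have h2 : μ.real (Rc ∩ D) ≤ 0 := hDle.trans (le_of_eq h0)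
      exact (h1.trans h2).trans measureReal_nonneg
    · have hpos : 0 < μ.real (Ry ∩ D) := lt_of_le_of_ne measureReal_nonneg (Ne.symm h0)
      have h3 : μ.real (D ∩ (Rc ∩ X)) * μ.real (Ry ∩ D) ≤ μ.real (D ∩ (X ∩ Ry)) * μ.real (Ry ∩ D) := by
        calc μ.real (D ∩ (Rc ∩ X)) * μ.real (Ry ∩ D) ≤ μ.real (Rc ∩ D) * μ.real (D ∩ (X ∩ Ry)) := hE
          _ ≤ μ.real (Ry ∩ D) * μ.real (D ∩ (X ∩ Ry)) :=
            mul_le_mul_of_nonneg_right hDle measureReal_nonneg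
          _ = μ.real (D ∩ (X ∩ Ry)) * μ.real (Ry ∩ D) := mul_comm _ _
      exact le_of_mul_le_mul_right h3 hpos
  linarith

/-- **QGR in margin form.**  With `s_v = μ(R_v)`: the margin of `c` over the glued pair `{x, y}` on `{c ↮ x, c ↮ y}`,
`μ(c ↮ x, c ↮ y, |π(c)| ≤ j) − μ(c ↮ x, c ↮ y, 1 ≤ |π(x) ∪ π(y)| ≤ j)`, is at least `min 0 (s_c − s_y)`. -/
theorem glued_margin_ge_min (w : Sym2 (Fin n) → unitInterval) (A : Finset (Fin n)) (x y c : Fin n) (j : ℕ) :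
    min 0 ((prodBernoulli w).real {ω : BondConfig (Fin n) | (A.filter fun z => ω ∈ openConn c z).card ≤ j} -
        (prodBernoulli w).real {ω : BondConfig (Fin n) | (A.filter fun z => ω ∈ openConn y z).card ≤ j}) ≤
      (prodBernoulli w).real {ω : BondConfig (Fin n) | ω ∉ openConn c x ∧ ω ∉ openConn c y ∧
          (A.filter fun z => ω ∈ openConn c z).card ≤ j} -
        (prodBernoulli w).real {ω : BondConfig (Fin n) | ω ∉ openConn c x ∧ ω ∉ openConn c y ∧
          1 ≤ (A.filter fun z => ω ∈ openConn x z ∨ ω ∈ openConn y z).card ∧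
          (A.filter fun z => ω ∈ openConn x z ∨ ω ∈ openConn y z).card ≤ j} := by
  have h := twoObserver_le_add_posPart w A x y c j
  rcases le_total
      ((prodBernoulli w).real {ω : BondConfig (Fin n) | (A.filter fun z => ω ∈ openConn y z).card ≤ j})
      ((prodBernoulli w).real {ω : BondConfig (Fin n) | (A.filter fun z => ω ∈ openConn c z).card ≤ j})
    with hyc | hcy
  · rw [max_eq_left (sub_nonpos.2 hyc)] at h
    rw [min_eq_left (sub_nonneg.2 hyc)]
    linarith
  · rw [max_eq_right (sub_nonneg.2 hcy)] at h
    rw [min_eq_right (sub_nonpos.2 hcy)]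
    linarith

end AttachedChampionGluingResponse

end Summit.CriticalPhenomena.PercolationContinuityZ3.Theorems

end
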